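import Summits.CriticalPhenomena.SAWScalingLimit.Theorems.SAWDevelopingMapObservableToSLETypeLadderCarvedReductionSqueezeGateCorridor
import HarnessLib

/-!
# The two corridors of the framed super-domain with the squeeze's radii: per-gate clauses,
# separation, and the avoided set of the pinned walks (piece (T-A′ P1-both) of stub T-A′
# `stub_carvedReduction_squeezeGeometry_domains`)

Crux `SAWDevelopingMap.ObservableToSLE` (stmt-CriticalPhenomena-10472), line `six-class-type-ladder`,
stub T-A′ `stub_carvedReduction_squeezeGeometry_domains`.  Landing target:
`Summits/CriticalPhenomena/SAWScalingLimit/Theorems/SAWDevelopingMapObservableToSLETypeLadderCarvedReductionSqueezeSupCorridors.lean`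
(`--supports stmt-CriticalPhenomena-10472`; registered carrier `stub_carvedReduction_supCorridors`).
Sequel of `…SqueezeGateCorridor` (p145153); consumes the separation data of
`stub_carvedReduction_exits` (p144216) and `stub_carvedReduction_coneFar` (p145078) as hypotheses.

Definitions (the fixed radii of the worker log, E3): `gateO B F P ρ` — the corridor of the gate
`P` (low box `ρ/16 × (ρ/128, 7ρ/16)` minus the lowered disc `closedBall (P - (ρ/128) i) (ρ/64)`,
body zone `{infDist · B < ρ/8}`, exit zone `F`); `gateRect P ρ` — the closed frame rectangle
`[re P ± ρ/64] × [im P - ρ/128, im P]`; `gateX B F P ρ` — the set avoided by present pinned walks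
(`…WalkOffZones` with `Fset := F 0 ∪ F 1`, `r i := ρ/8`, `R₁ := ρ/2`, `μ := ρ/64`).
`stub_carvedReduction_supCorridors`: for two gates `P i` within `R` of the pinned roots `α i`
(`dist (α 0) (α 1) > 2 (R + ρ)`, the exit cone of each gate `ε`-far from the other root with
`R + ρ ≤ ε`), the corridors `gateO (B i) (F i) (P i) ρ` satisfy ALL corridor/separation hypotheses
of `stub_carvedReduction_superFrame` (with `ρ' := ρ/64`, `h := ρ/128`, `ρw := ρ/128`), lie with
the rectangles inside `gateX`, and the open upper half-discs `{im > im (P i)} ∩ ball (P i) (ρ/128)`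
as well as `J ∖ gateX` lie in `J ∖ (O 0 ∪ O 1 ∪ R 0 ∪ R 1)` (inputs of `…LinkSup`, `…ReachSup`), and the
corridor lies in `F ∪ zone ∪ ({im < im P - ρ/128} ∩ ball P (ρ/2 - ρ/64))` (the near obstacles of `…ReachSup`).
-/

noncomputable section
open scoped Topology
open Filter Set Metric
open Literature.Probability.RandomPlanarGeometry

namespace Summit.CriticalPhenomena.SAWScalingLimit.Theorems.ObservableToSLE.TypeLadder

/-- The corridor of the gate `P` (window radius `ρ`, limit body `B`, exit zone `F`) with the
squeeze's radii. -/
def gateO (B F : Set ℂ) (P : ℂ) (ρ : ℝ) : Set ℂ :=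
  ({z : ℂ | |z.re - P.re| < ρ / 16 ∧ P.im - 7 * ρ / 16 < z.im ∧ z.im < P.im - ρ / 128} \
      closedBall (P - ((ρ / 128 : ℝ) : ℂ) * Complex.I) (ρ / 64)) ∪ {z : ℂ | infDist z B < ρ / 8} ∪ F

/-- The closed frame rectangle `[re P ± ρ/64] × [im P - ρ/128, im P]` of the gate `P`. -/
def gateRect (P : ℂ) (ρ : ℝ) : Set ℂ :=
  {z : ℂ | |z.re - P.re| ≤ ρ / 64 ∧ P.im - ρ / 128 ≤ z.im ∧ z.im ≤ P.im}

/-- The set avoided by present pinned walks: exit zones, body zones, closed lower half-balls. -/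
def gateX (B F : Fin 2 → Set ℂ) (P : Fin 2 → ℂ) (ρ : ℝ) : Set ℂ :=
  (F 0 ∪ F 1 ∪ ⋃ i, {z : ℂ | infDist z (B i) < ρ / 8}) ∪
    ⋃ i, ({z : ℂ | z.im ≤ (P i).im} ∩ closedBall (P i) (ρ / 2 - ρ / 64))

/-- **Registered carrier `stub_carvedReduction_supCorridors`** (crux item stmt-CriticalPhenomena-10472,
stub T-A′ `stub_carvedReduction_squeezeGeometry_domains`, piece THE TWO CORRIDORS); see the module
docstring. -/
theorem stub_carvedReduction_supCorridors :
    ∀ (J : Set ℂ) (F B : Fin 2 → Set ℂ) (x : Fin 2 → Fin 2 → ℂ) (P α : Fin 2 → ℂ) (ρ R : ℝ),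
      IsOpen J → 0 < ρ → (∀ i, dist (P i) (α i) ≤ R) → 2 * (R + ρ) < dist (α 0) (α 1) →
      (∀ i, ball (P i) (ρ / 2) ⊆ J) → (∀ i, closedBall (α i) (R + ρ) ⊆ J) →
      (∀ i, IsConnected (B i)) → (∀ i, P i - ((ρ / 2 : ℝ) : ℂ) * Complex.I ∈ B i) → (∀ i, B i ⊆ closedBall (α i) R) →
      (∀ i, ∀ b ∈ B i, ∀ z : ℂ, dist z (P i) < ρ / 2 → (P i).im < z.im → ρ / 4 ≤ dist b z) →
      (∀ i, IsOpen (F i)) → (∀ i, IsConnected (F i)) → (∀ i, F i ⊆ J) → (∀ i, Disjoint (F i) (ball (P i) (ρ / 2))) →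
      (∀ i, (F i ∩ {z : ℂ | infDist z (B i) < ρ / 8}).Nonempty) →
      Disjoint (F 0 ∪ {x 0 0, x 0 1}) (F 1 ∪ {x 1 0, x 1 1}) → (∀ i k, x i k ∉ J) →
      (∀ i k, i ≠ k → Disjoint (F k) (ball (α i) (R + ρ))) →
      (∀ i, IsOpen (gateO (B i) (F i) (P i) ρ)) ∧ (∀ i, IsConnected (gateO (B i) (F i) (P i) ρ)) ∧
      (∀ i, gateO (B i) (F i) (P i) ρ ⊆ J) ∧
      (∀ i, Disjoint (gateO (B i) (F i) (P i) ρ) (gateRect (P i) ρ)) ∧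
      (∀ i, Disjoint (gateO (B i) (F i) (P i) ρ) (closedBall (P i) (ρ / 128))) ∧
      (∀ i, Disjoint (gateO (B i) (F i) (P i) ρ) (closedBall (P i - ((ρ / 128 : ℝ) : ℂ) * Complex.I) (ρ / 64))) ∧
      (∀ i, segment ℝ (P i - ((ρ / 128 : ℝ) : ℂ) * Complex.I - ((ρ / 64 : ℝ) : ℂ))
          (P i - ((ρ / 128 : ℝ) : ℂ) * Complex.I - ((ρ / 64 : ℝ) : ℂ) - (((ρ / 64) / 2 : ℝ) : ℂ) * Complex.I) \
        {P i - ((ρ / 128 : ℝ) : ℂ) * Complex.I - ((ρ / 64 : ℝ) : ℂ)} ⊆ gateO (B i) (F i) (P i) ρ) ∧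
      (∀ i, segment ℝ (P i - ((ρ / 128 : ℝ) : ℂ) * Complex.I + ((ρ / 64 : ℝ) : ℂ))
          (P i - ((ρ / 128 : ℝ) : ℂ) * Complex.I + ((ρ / 64 : ℝ) : ℂ) - (((ρ / 64) / 2 : ℝ) : ℂ) * Complex.I) \
        {P i - ((ρ / 128 : ℝ) : ℂ) * Complex.I + ((ρ / 64 : ℝ) : ℂ)} ⊆ gateO (B i) (F i) (P i) ρ) ∧
      (∀ i, gateRect (P i) ρ ⊆ J) ∧ (∀ i, closedBall (P i) (ρ / 128) ⊆ J) ∧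
      (∀ i, closedBall (P i - ((ρ / 128 : ℝ) : ℂ) * Complex.I) (ρ / 64) ⊆ J) ∧
      Disjoint (gateO (B 0) (F 0) (P 0) ρ ∪ gateRect (P 0) ρ ∪ {x 0 0, x 0 1})
        (gateO (B 1) (F 1) (P 1) ρ ∪ gateRect (P 1) ρ ∪ {x 1 0, x 1 1}) ∧
      (∀ i k, i ≠ k → Disjoint (gateO (B i) (F i) (P i) ρ ∪ gateRect (P i) ρ ∪ {x i 0, x i 1}) (closedBall (P k) (ρ / 128))) ∧
      (∀ i, gateO (B i) (F i) (P i) ρ ∪ gateRect (P i) ρ ⊆ gateX B F P ρ) ∧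
      (∀ i, {z : ℂ | (P i).im < z.im} ∩ ball (P i) (ρ / 128) ⊆
        J \ (gateO (B 0) (F 0) (P 0) ρ ∪ gateO (B 1) (F 1) (P 1) ρ ∪ gateRect (P 0) ρ ∪ gateRect (P 1) ρ)) ∧
      J \ gateX B F P ρ ⊆ J \ (gateO (B 0) (F 0) (P 0) ρ ∪ gateO (B 1) (F 1) (P 1) ρ ∪ gateRect (P 0) ρ ∪ gateRect (P 1) ρ) ∧
      (∀ i, gateO (B i) (F i) (P i) ρ ⊆ F i ∪ {z : ℂ | infDist z (B i) < ρ / 8} ∪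
        ({z : ℂ | z.im < (P i).im - ρ / 128} ∩ ball (P i) (ρ / 2 - ρ / 64))) := by
  intro J F B x P α ρ R hJo hρ hPα hsep hballJ hαJ hBc hgB hBα hBfar hFo hFc hFJ hFball hFZ hFx hxJ hcone
  have key : ∀ i, _ := fun i => stub_carvedReduction_gateCorridor J (B i) (F i) (P i) (α i) ρ R hρ (hPα i) (hballJ i) (hαJ i)
    (hBc i) (hgB i) (hBα i) (hBfar i) (hFo i) (hFc i) (hFJ i) (hFball i) (hFZ i)
  -- unpack the per-gate clauses (the `let` of `gateCorridor` is `gateO`)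
  have hO : ∀ i, IsOpen (gateO (B i) (F i) (P i) ρ) ∧ IsConnected (gateO (B i) (F i) (P i) ρ) ∧ gateO (B i) (F i) (P i) ρ ⊆ J ∧
      Disjoint (gateO (B i) (F i) (P i) ρ) (gateRect (P i) ρ) ∧
      Disjoint (gateO (B i) (F i) (P i) ρ) (closedBall (P i) (ρ / 128)) ∧
      Disjoint (gateO (B i) (F i) (P i) ρ) (closedBall (P i - ((ρ / 128 : ℝ) : ℂ) * Complex.I) (ρ / 64)) ∧
      segment ℝ (P i - ((ρ / 128 : ℝ) : ℂ) * Complex.I - ((ρ / 64 : ℝ) : ℂ))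
          (P i - ((ρ / 128 : ℝ) : ℂ) * Complex.I - ((ρ / 64 : ℝ) : ℂ) - (((ρ / 64) / 2 : ℝ) : ℂ) * Complex.I) \
        {P i - ((ρ / 128 : ℝ) : ℂ) * Complex.I - ((ρ / 64 : ℝ) : ℂ)} ⊆ gateO (B i) (F i) (P i) ρ ∧
      segment ℝ (P i - ((ρ / 128 : ℝ) : ℂ) * Complex.I + ((ρ / 64 : ℝ) : ℂ))
          (P i - ((ρ / 128 : ℝ) : ℂ) * Complex.I + ((ρ / 64 : ℝ) : ℂ) - (((ρ / 64) / 2 : ℝ) : ℂ) * Complex.I) \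
        {P i - ((ρ / 128 : ℝ) : ℂ) * Complex.I + ((ρ / 64 : ℝ) : ℂ)} ⊆ gateO (B i) (F i) (P i) ρ ∧
      gateRect (P i) ρ ⊆ J ∧ closedBall (P i) (ρ / 128) ⊆ J ∧ closedBall (P i - ((ρ / 128 : ℝ) : ℂ) * Complex.I) (ρ / 64) ⊆ J ∧
      gateO (B i) (F i) (P i) ρ ∪ gateRect (P i) ρ ⊆
        F i ∪ {z : ℂ | infDist z (B i) < ρ / 8} ∪ ({z : ℂ | z.im ≤ (P i).im} ∩ closedBall (P i) (ρ / 2 - ρ / 64)) ∧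
      Disjoint ({z : ℂ | (P i).im < z.im} ∩ ball (P i) (ρ / 128)) (gateO (B i) (F i) (P i) ρ ∪ gateRect (P i) ρ) ∧
      gateO (B i) (F i) (P i) ρ ∪ gateRect (P i) ρ ∪ closedBall (P i) (ρ / 128) ⊆ F i ∪ ball (α i) (R + ρ) :=
    fun i => key i
  have hOX : ∀ i, gateO (B i) (F i) (P i) ρ ∪ gateRect (P i) ρ ⊆
      F i ∪ {z : ℂ | infDist z (B i) < ρ / 8} ∪ ({z : ℂ | z.im ≤ (P i).im} ∩ closedBall (P i) (ρ / 2 - ρ / 64)) :=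
    fun i => (hO i).2.2.2.2.2.2.2.2.2.2.2.1
  have hUH : ∀ i, Disjoint ({z : ℂ | (P i).im < z.im} ∩ ball (P i) (ρ / 128)) (gateO (B i) (F i) (P i) ρ ∪ gateRect (P i) ρ) :=
    fun i => (hO i).2.2.2.2.2.2.2.2.2.2.2.2.1
  have hfarα : ∀ i, gateO (B i) (F i) (P i) ρ ∪ gateRect (P i) ρ ∪ closedBall (P i) (ρ / 128) ⊆ F i ∪ ball (α i) (R + ρ) :=
    fun i => (hO i).2.2.2.2.2.2.2.2.2.2.2.2.2
  -- separation tools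
  have hballs : Disjoint (ball (α 0) (R + ρ)) (ball (α 1) (R + ρ)) :=
    ball_disjoint_ball (by linarith)
  have hnear : ∀ i, gateO (B i) (F i) (P i) ρ ∪ gateRect (P i) ρ ∪ closedBall (P i) (ρ / 128) ⊆ J := fun i =>
    union_subset (union_subset (hO i).2.2.1 (hO i).2.2.2.2.2.2.2.2.1) (hO i).2.2.2.2.2.2.2.2.2.1
  have hαball : ∀ i k, i ≠ k → Disjoint (ball (α i) (R + ρ)) (ball (α k) (R + ρ)) := by
    intro i k hik
    fin_cases i <;> fin_cases k
    · exact absurd rfl hik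
    · exact hballs
    · exact hballs.symm
    · exact absurd rfl hik
  have hFF : Disjoint (F 0) (F 1) := Set.disjoint_of_subset subset_union_left subset_union_left hFx
  have hcross : ∀ i k, i ≠ k → Disjoint (F i ∪ ball (α i) (R + ρ)) (F k ∪ ball (α k) (R + ρ)) := by
    intro i k hik
    have hFik : Disjoint (F i) (F k) := by
      fin_cases i <;> fin_cases k
      · exact absurd rfl hik
      · exact hFF
      · exact hFF.symm
      · exact absurd rfl hik
    exact Set.disjoint_union_left.2 ⟨Set.disjoint_union_right.2 ⟨hFik, hcone k i (Ne.symm hik)⟩,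
      Set.disjoint_union_right.2 ⟨(hcone i k hik).symm, hαball i k hik⟩⟩
  refine ⟨fun i => (hO i).1, fun i => (hO i).2.1, fun i => (hO i).2.2.1, fun i => (hO i).2.2.2.1, fun i => (hO i).2.2.2.2.1,
    fun i => (hO i).2.2.2.2.2.1, fun i => (hO i).2.2.2.2.2.2.1, fun i => (hO i).2.2.2.2.2.2.2.1,
    fun i => (hO i).2.2.2.2.2.2.2.2.1, fun i => (hO i).2.2.2.2.2.2.2.2.2.1, fun i => (hO i).2.2.2.2.2.2.2.2.2.2.1,
    ?_, ?_, ?_, ?_, ?_, ?_⟩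
  · -- `hsep`
    refine Set.disjoint_left.2 fun z hz0 hz1 => ?_
    rcases hz0 with hz0 | hz0 <;> rcases hz1 with hz1 | hz1
    · have h0 := hfarα 0 (Or.inl hz0)
      have h1 := hfarα 1 (Or.inl hz1)
      exact Set.disjoint_left.1 (hcross 0 1 (by decide)) h0 h1
    · have : z ∈ J := hnear 0 (Or.inl hz0)
      rcases hz1 with rfl | rfl <;> exact hxJ 1 _ this
    · have : z ∈ J := hnear 1 (Or.inl hz1)
      rcases hz0 with rfl | rfl <;> exact hxJ 0 _ this
    · exact Set.disjoint_left.1 hFx (Or.inr hz0) (Or.inr hz1)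
  · -- `hsepB`
    intro i k hik
    refine Set.disjoint_left.2 fun z hzi hzk => ?_
    rcases hzi with hzi | hzi
    · have h0 := hfarα i (Or.inl hzi)
      have h1 := hfarα k (Or.inr hzk)
      exact Set.disjoint_left.1 (hcross i k hik) h0 h1
    · have : z ∈ J := hnear k (Or.inr hzk)
      rcases hzi with rfl | rfl <;> exact hxJ i _ this
  · -- `O ∪ R ⊆ gateX`
    intro i z hz
    rcases hOX i hz with (hz' | hz') | hz'
    · refine Or.inl (Or.inl ?_)
      fin_cases i
      · exact Or.inl hz'
      · exact Or.inr hz'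
    · exact Or.inl (Or.inr (mem_iUnion.2 ⟨i, hz'⟩))
    · exact Or.inr (mem_iUnion.2 ⟨i, hz'⟩)
  · -- the open upper half-discs are good
    intro i z hz
    have hzJ : z ∈ J := hballJ i (ball_subset_ball (by linarith) hz.2)
    have hzαi : z ∈ ball (α i) (R + ρ) := by
      have := mem_ball.1 hz.2
      rw [mem_ball]; linarith [dist_triangle z (P i) (α i), hPα i]
    have hself : z ∉ gateO (B i) (F i) (P i) ρ ∪ gateRect (P i) ρ := fun h =>
      Set.disjoint_left.1 (hUH i) hz h
    have hother : ∀ k, k ≠ i → z ∉ gateO (B k) (F k) (P k) ρ ∪ gateRect (P k) ρ := by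
      intro k hki h
      have h1 := hfarα k (Or.inl h)
      exact Set.disjoint_left.1 (hcross i k (Ne.symm hki)) (Or.inr hzαi) h1
    refine ⟨hzJ, ?_⟩
    rintro (((h | h) | h) | h)
    · by_cases h0 : (0 : Fin 2) = i
      · subst h0; exact hself (Or.inl h)
      · exact hother 0 h0 (Or.inl h)
    · by_cases h1 : (1 : Fin 2) = i
      · subst h1; exact hself (Or.inl h)
      · exact hother 1 h1 (Or.inl h)
    · by_cases h0 : (0 : Fin 2) = i
      · subst h0; exact hself (Or.inr h)
      · exact hother 0 h0 (Or.inr h)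
    · by_cases h1 : (1 : Fin 2) = i
      · subst h1; exact hself (Or.inr h)
      · exact hother 1 h1 (Or.inr h)
  · -- `J ∖ gateX` is good
    rintro z ⟨hzJ, hzX⟩
    refine ⟨hzJ, ?_⟩
    have hsub : ∀ i, gateO (B i) (F i) (P i) ρ ∪ gateRect (P i) ρ ⊆ gateX B F P ρ := by
      intro i w hw
      rcases hOX i hw with (hw' | hw') | hw'
      · refine Or.inl (Or.inl ?_)
        fin_cases i
        · exact Or.inl hw'
        · exact Or.inr hw'
      · exact Or.inl (Or.inr (mem_iUnion.2 ⟨i, hw'⟩))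
      · exact Or.inr (mem_iUnion.2 ⟨i, hw'⟩)
    rintro (((h | h) | h) | h)
    · exact hzX (hsub 0 (Or.inl h))
    · exact hzX (hsub 1 (Or.inl h))
    · exact hzX (hsub 0 (Or.inr h))
    · exact hzX (hsub 1 (Or.inr h))
  · -- the finer location of the corridor: the low box lies strictly below depth `ρ/128`, inside `ball (P i) (ρ/2 - ρ/64)`
    intro i z hz
    rcases hz with (hz | hz) | hz
    · obtain ⟨⟨hre, him1, him2⟩, -⟩ := hz
      refine Or.inr ⟨him2, mem_ball.2 ?_⟩
      have hd2 : dist z (P i) ^ 2 = (z.re - (P i).re) ^ 2 + (z.im - (P i).im) ^ 2 := by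
        rw [dist_eq_norm, Complex.sq_norm, Complex.normSq_apply]; simp; ring
      have hre2 : (z.re - (P i).re) ^ 2 < (ρ / 16) ^ 2 := by
        have := abs_lt.1 hre; nlinarith
      have him2' : (z.im - (P i).im) ^ 2 < (7 * ρ / 16) ^ 2 := by nlinarith
      have hlt : dist z (P i) ^ 2 < (ρ / 2 - ρ / 64) ^ 2 := by rw [hd2]; nlinarith
      exact lt_of_pow_lt_pow_left₀ 2 (by linarith) hlt
    · exact Or.inl (Or.inr hz)
    · exact Or.inl (Or.inl hz)

end Summit.CriticalPhenomena.SAWScalingLimit.Theorems.ObservableToSLE.TypeLadder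

end
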